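import Mathlib
import Literature.Computability.AlgebraicComplexity.GroupTheoreticMatMul
import Literature.Combinatorics.Additive.Kneser
import Summits.MatrixMultiplication.OmegaCensus.STPPDisjointPacking
import Summits.MatrixMultiplication.OmegaCensus.STPPPatternMonotonicity
import Summits.MatrixMultiplication.MatrixMultiplication.Theorems.GroupTheoreticSTPPCThesisNoFour444Order127

/-!
# The second-moment («Lemma Δ») energy bound for STPP families, and the T_E residuals at 111, 120, 124, 126

Support file for route `MatrixMultiplication/GroupTheoreticSTPP`, crux `stmt-MatrixMultiplication-0597`, and for the
cell route `AbelianSTPPCensus` (cruxes `TEResidualSmall` 111/120, `TEResidualLarge` 124 mixed/126); cell `mm-stpp` (D-0046).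
Mechanism = the lit seat's rule U11-Δ (HOME/mm-stpp-lit/KNESER-KILLS.md §4, REF PASS) in the letters of
`GroupTheoreticSTPPCThesisNoFour444Order124/127.lean` (mm-stpp-eng-2): with `D = ⋃(A t − B t)`, `E = ⋃(B t − C t)`,
`F = ⋃(C t − A t)` and the exact representation count `#{f ∈ F : −d − f ∈ E} = |C i|` for `d ∈ A i − B i`
(`card_filter_rep_eq`), two translates `−d − F`, `−d' − F` both almost cover the complement of `E`, so `F` has the
near-period `d − d'` with defect `≤ (|H| − |E|) − 2(|F| − max |C i|)`; summing the translation counts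
`g_F(t) = #{f ∈ F : f + t ∈ F}` over `t ∈ D − D` and comparing with `Σ_t g_F(t) = |F|²` gives

* `energy_lower_bound` — `|D − D| · (2|F| − 2·cmax − (|H| − |E|)) ≤ |F|²` (truncated subtraction);

and **Kneser's theorem** (`Literature.Combinatorics.Additive.add_kneser`, lit seat) bounds `|D − D|` from below
(`kneser_lower_bound`: `|D − D| ≥ 2q⌈|D|/q⌉ − q` for the stabiliser order `q ∣ |H|`).  Instances:

* `no_isSTPP_444x4_order126` — Q3.12 at 126 (`|D − D| = 126`, `126·58 > 64²`);
* `no_isSTPP_543_345_444x2_order124` (+ two rotations) — Q3.11 mixed multiset (`124·54 > 62²`);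
* `no_isSTPP_444x3_443_order120` (+ two rotations) — Q3.10 at 120 (`120·52 > 60²`);
* `no_isSTPP_444x3_333_order111` — Q3.9 (`111·52 > 57²`).

WHAT THIS IS NOT: no `ω` statement; finitely many residual instances of the abelian T_E census.
-/

-- single-conjunct summit: the mandated namespace repeats `MatrixMultiplication`.
set_option linter.dupNamespace false

namespace Summit.MatrixMultiplication.MatrixMultiplication.Theorems

namespace STPPEnergy

open Finset Literature.Computability.AlgebraicComplexity Literature.Combinatorics.Additive
open scoped Pointwise

variable {H : Type*} [AddCommGroup H] [Fintype H] [DecidableEq H] {N : ℕ} {A B C : Fin N → Finset H}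

omit [Fintype H] in
/-- The representation count read inside `F`: `#{f ∈ F : x − f ∈ E} = #{e ∈ E : x − e ∈ F}`. [folklore] -/
theorem card_filter_rep_swap (E F : Finset H) (x : H) :
    (F.filter fun f => x - f ∈ E).card = (E.filter fun e => x - e ∈ F).card := by
  refine card_bij (fun f _ => x - f) (fun f hf => ?_) (fun a _ b _ hab => by simpa using hab)
    (fun e he => ⟨x - e, ?_, by simp⟩)
  · rw [mem_filter] at hf ⊢; exact ⟨hf.2, by simpa using hf.1⟩
  · rw [mem_filter] at he ⊢; exact ⟨he.2, by simpa using he.1⟩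

/-- **Lemma Δ (near-periods from exact representation counts).**  For any `x, x'`:
`#{f ∈ F : x − f ∉ E} + #{f ∈ F : x' − f ∉ E} ≤ #{f ∈ F : f + (x − x') ∈ F} + #(Hᶜ of E)`: the two translates
`x − F`, `x' − F` meet the complement of `E` in sets whose intersection injects into the `(x − x')`-periods of `F`.
[cite: Nathanson1996, §4.1] -/
theorem card_filter_notMem_add_le (E F : Finset H) (x x' : H) :
    (F.filter fun f => x - f ∉ E).card + (F.filter fun f => x' - f ∉ E).card
      ≤ (F.filter fun f => f + (x - x') ∈ F).card + (univ \ E).card := by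
  set I := (F.filter fun f => x - f ∉ E).image fun f => x - f
  set I' := (F.filter fun f => x' - f ∉ E).image fun f => x' - f
  have hI : I.card = (F.filter fun f => x - f ∉ E).card :=
    card_image_of_injective _ fun a b hab => by simpa using hab
  have hI' : I'.card = (F.filter fun f => x' - f ∉ E).card :=
    card_image_of_injective _ fun a b hab => by simpa using hab
  have hIW : I ⊆ univ \ E := by
    intro w hw; rw [mem_image] at hw; obtain ⟨f, hf, rfl⟩ := hw
    exact mem_sdiff.2 ⟨mem_univ _, (mem_filter.1 hf).2⟩
  have hI'W : I' ⊆ univ \ E := by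
    intro w hw; rw [mem_image] at hw; obtain ⟨f, hf, rfl⟩ := hw
    exact mem_sdiff.2 ⟨mem_univ _, (mem_filter.1 hf).2⟩
  have hmeet : (I ∩ I').card ≤ (F.filter fun f => f + (x - x') ∈ F).card := by
    refine card_le_card_of_injOn (fun w => x' - w) (fun w hw => ?_) (fun a _ b _ hab => by simpa using hab)
    rw [coe_inter, Set.mem_inter_iff, mem_coe, mem_coe, mem_image, mem_image] at hw
    obtain ⟨⟨f, hf, rfl⟩, ⟨f', hf', hff'⟩⟩ := hw
    rw [mem_coe, mem_filter]
    change x' - (x - f) ∈ F ∧ x' - (x - f) + (x - x') ∈ F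
    refine ⟨?_, ?_⟩
    · have : x' - (x - f) = f' := by rw [← hff']; abel
      rw [this]; exact (mem_filter.1 hf').1
    · have : x' - (x - f) + (x - x') = f := by abel
      rw [this]; exact (mem_filter.1 hf).1
  have hunion : (I ∪ I').card ≤ (univ \ E).card := card_le_card (union_subset hIW hI'W)
  have := card_union_add_card_inter I I'
  omega

/-- **The second-moment energy bound.**  For an `IsSTPP` family with non-empty sets, `D = ⋃(A t − B t)`,
`E = ⋃(B t − C t)`, `F = ⋃(C t − A t)`, any bound `cmax ≥ |C i|` and any `L ≤ |D − D|`: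
`L · (2|F| − 2 cmax − (|H| − |E|)) ≤ |F|²` (natural-number subtraction). [cite: Nathanson1996, §4.1] -/
theorem energy_lower_bound (h : IsSTPP A B C)
    (cmax : ℕ) (hcmax : ∀ i, (C i).card ≤ cmax) (L : ℕ)
    (hL : L ≤ ((univ.biUnion fun t => A t - B t) - (univ.biUnion fun t => A t - B t)).card) :
    L * (2 * (univ.biUnion fun t => C t - A t).card - 2 * cmax
        - (Fintype.card H - (univ.biUnion fun t => B t - C t).card))
      ≤ (univ.biUnion fun t => C t - A t).card * (univ.biUnion fun t => C t - A t).card := by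
  set D := univ.biUnion fun t => A t - B t with hDdef
  set E := univ.biUnion fun t => B t - C t with hEdef
  set F := univ.biUnion fun t => C t - A t with hFdef
  set g : H → ℕ := fun t => (F.filter fun f => f + t ∈ F).card with hgdef
  -- exact count at the points of −D
  have hrep : ∀ i, ∀ d ∈ A i - B i, (F.filter fun f => -d - f ∉ E).card = F.card - (C i).card := by
    intro i d hd
    have h1 := card_filter_add_card_filter_not (s := F) (fun f => -d - f ∈ E)
    have h2 : (F.filter fun f => -d - f ∈ E).card = (C i).card := by
      rw [card_filter_rep_swap, hEdef, hFdef]; exact card_filter_rep_eq h i hd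
    omega
  -- per-difference bound on D − D
  have hper : ∀ t ∈ D - D, 2 * F.card - 2 * cmax - (Fintype.card H - E.card) ≤ g t := by
    intro t ht
    rw [mem_sub] at ht
    obtain ⟨d, hd, d', hd', rfl⟩ := ht
    rw [hDdef, mem_biUnion_sub] at hd hd'
    obtain ⟨i, a, ha, b, hb, rfl⟩ := hd
    obtain ⟨j, a', ha', b', hb', rfl⟩ := hd'
    have hdi : a - b ∈ A i - B i := sub_mem_sub ha hb
    have hdj : a' - b' ∈ A j - B j := sub_mem_sub ha' hb'
    have hΔ := card_filter_notMem_add_le E F (-(a' - b')) (-(a - b))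
    rw [hrep j _ hdj, hrep i _ hdi] at hΔ
    have hE : (univ \ E).card = Fintype.card H - E.card := by
      rw [card_sdiff_of_subset (subset_univ _), card_univ]
    have ht : -(a' - b') - -(a - b) = a - b - (a' - b') := by abel
    rw [hE, ht] at hΔ
    have hi := hcmax i; have hj := hcmax j
    have hFC : (C i).card ≤ F.card := by
      have : (F.filter fun f => -(a - b) - f ∈ E).card = (C i).card := by
        rw [card_filter_rep_swap, hEdef, hFdef]; exact card_filter_rep_eq h i hdi
      rw [← this]; exact card_filter_le _ _
    simp only [hgdef]
    omega
  have htot : ∑ t, g t = F.card * F.card := by simp only [hgdef]; rw [sum_card_filter_add_mem]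
  have hsum : (D - D).card * (2 * F.card - 2 * cmax - (Fintype.card H - E.card)) ≤ ∑ t ∈ D - D, g t := by
    rw [← smul_eq_mul, ← sum_const]; exact sum_le_sum hper
  have hsub : ∑ t ∈ D - D, g t ≤ ∑ t, g t :=
    sum_le_sum_of_subset_of_nonneg (subset_univ _) fun _ _ _ => Nat.zero_le _
  calc L * (2 * F.card - 2 * cmax - (Fintype.card H - E.card))
      ≤ (D - D).card * (2 * F.card - 2 * cmax - (Fintype.card H - E.card)) := Nat.mul_le_mul_right _ hL
    _ ≤ F.card * F.card := by rw [← htot]; exact hsum.trans hsub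

/-- **Kneser lower bound for `|D − D|`.**  In a finite abelian group, for non-empty `D` there is a divisor `q`
of `|H|` (the order of the stabiliser of `D − D`) and a multiple `q·u ≥ |D|` with `2·q·u ≤ |D − D| + q`.
[cite: Nathanson1996, Thm 4.3] -/
theorem kneser_lower_bound (D : Finset H) (hD : D.Nonempty) :
    ∃ q u : ℕ, q ∣ Fintype.card H ∧ D.card ≤ q * u ∧ 2 * (q * u) ≤ (D - D).card + q := by
  set K := (D - D).addStab with hK
  have hkn := add_kneser D (-D)
  rw [← sub_eq_add_neg, ← hK] at hkn
  have hdvd : K.card ∣ Fintype.card H := by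
    have := (hD.add hD.neg).card_addStab_dvd_card_univ; rwa [← sub_eq_add_neg, ← hK] at this
  have hdS : K.card ∣ (D + K).card := by
    have := card_addStab_dvd_card_add_addStab D (D + -D); rwa [← sub_eq_add_neg, ← hK] at this
  have hdT : K.card ∣ (-D + K).card := by
    have := card_addStab_dvd_card_add_addStab (-D) (D + -D); rwa [← sub_eq_add_neg, ← hK] at this
  have hKne : K.Nonempty := by
    have := (hD.add hD.neg).addStab; rwa [← sub_eq_add_neg, ← hK] at this
  have hSK : D.card ≤ (D + K).card := card_le_card_add_right hKne
  have hTK : D.card ≤ (-D + K).card := by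
    have := card_le_card_add_right hKne (s := -D); rwa [card_neg] at this
  obtain ⟨u, hu⟩ := hdS
  obtain ⟨v, hv⟩ := hdT
  rcases le_total u v with huv | hvu
  · refine ⟨K.card, u, hdvd, by rw [← hu]; exact hSK, ?_⟩
    have : K.card * u ≤ K.card * v := Nat.mul_le_mul_left _ huv
    rw [← hu]; omega
  · refine ⟨K.card, v, hdvd, by rw [← hv]; exact hTK, ?_⟩
    have : K.card * v ≤ K.card * u := Nat.mul_le_mul_left _ hvu
    rw [← hv]; omega

/-- **`d_min` test.**  If every divisor `q` of `|H|` and every multiple `q·u ≥ |D|` satisfy `L + q ≤ 2qu`, then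
`L ≤ |D − D|` (Kneser). [cite: Nathanson1996, Thm 4.3] -/
theorem le_card_sub_of_dmin (D : Finset H) (hD : D.Nonempty) (L : ℕ)
    (hcheck : ∀ q u k : ℕ, Fintype.card H = q * k → D.card ≤ q * u → L + q ≤ 2 * (q * u)) :
    L ≤ (D - D).card := by
  obtain ⟨q, u, ⟨k, hk⟩, hqu, h2⟩ := kneser_lower_bound D hD
  have := hcheck q u k hk hqu
  omega

/-- **No `IsSTPP` family of four `(4,4,4)` triples in an abelian group of order `126`** (T_E residual Q3.12 at
126; second-moment route; the hand proof TE-RESIDUALS §4 is a different, longer route). [original] -/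
theorem no_isSTPP_444x4_order126 (hH : Fintype.card H = 126) (A B C : Fin 4 → Finset H)
    (hA : ∀ i, (A i).card = 4) (hB : ∀ i, (B i).card = 4) (hC : ∀ i, (C i).card = 4) :
    ¬ IsSTPP A B C := by
  intro h
  have hAne : ∀ i, (A i).Nonempty := fun i => card_pos.1 (by rw [hA i]; norm_num)
  have hBne : ∀ i, (B i).Nonempty := fun i => card_pos.1 (by rw [hB i]; norm_num)
  have hCne : ∀ i, (C i).Nonempty := fun i => card_pos.1 (by rw [hC i]; norm_num)
  have hDc : (univ.biUnion fun t => A t - B t).card = 64 := by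
    rw [card_biUnion_sub h hCne]; simp [hA, hB]
  have hEc : (univ.biUnion fun t => B t - C t).card = 64 := by
    rw [card_biUnion_sub (OmegaCensus.stpp_rotate h) hAne]; simp [hB, hC]
  have hFc : (univ.biUnion fun t => C t - A t).card = 64 := by
    rw [card_biUnion_sub (OmegaCensus.stpp_rotate (OmegaCensus.stpp_rotate h)) hBne]; simp [hC, hA]
  have hL : 126 ≤ ((univ.biUnion fun t => A t - B t) - (univ.biUnion fun t => A t - B t)).card := by
    refine le_card_sub_of_dmin _ (card_pos.1 (by omega)) 126 fun q u k hk hqu => ?_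
    rw [hH] at hk; rw [hDc] at hqu
    have hq : q ≤ 126 := by
      rcases Nat.eq_zero_or_pos k with h0 | h0
      · rw [h0] at hk; omega
      · nlinarith
    interval_cases q <;> omega
  have := energy_lower_bound h 4 (fun i => (hC i).le) 126 hL
  rw [hEc, hFc, hH] at this
  omega

omit [Fintype H] [DecidableEq H] in
/-- Reindexing the members of an `IsSTPP` family by the transposition `(0 1)` of `Fin 4`. [folklore] -/
theorem isSTPP_swap01 {A B C : Fin 4 → Finset H} (h : IsSTPP A B C) :
    IsSTPP (fun i => A (![1, 0, 2, 3] i)) (fun i => B (![1, 0, 2, 3] i)) (fun i => C (![1, 0, 2, 3] i)) :=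
  OmegaCensus.isSTPP_subfamily h _ (by decide)

/-- **Q3.11, mixed multiset: no `IsSTPP` family with shapes `(5,4,3),(3,4,5),(4,4,4),(4,4,4)` in an abelian group
of order `124`** (`|D − D| = 124` by Kneser, per-difference bound `54`, `124·54 > 62²`). [original] -/
theorem no_isSTPP_543_345_444x2_order124 (hH : Fintype.card H = 124) (A B C : Fin 4 → Finset H)
    (hA : ∀ i, (A i).card = ![5, 3, 4, 4] i) (hB : ∀ i, (B i).card = 4) (hC : ∀ i, (C i).card = ![3, 5, 4, 4] i) :
    ¬ IsSTPP A B C := by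
  intro h
  have hAne : ∀ i, (A i).Nonempty := fun i => card_pos.1 (by rw [hA i]; fin_cases i <;> simp)
  have hBne : ∀ i, (B i).Nonempty := fun i => card_pos.1 (by rw [hB i]; norm_num)
  have hCne : ∀ i, (C i).Nonempty := fun i => card_pos.1 (by rw [hC i]; fin_cases i <;> simp)
  have hDc : (univ.biUnion fun t => A t - B t).card = 64 := by
    rw [card_biUnion_sub h hCne]; simp [hA, hB, Fin.sum_univ_four]
  have hEc : (univ.biUnion fun t => B t - C t).card = 64 := by
    rw [card_biUnion_sub (OmegaCensus.stpp_rotate h) hAne]; simp [hB, hC, Fin.sum_univ_four]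
  have hFc : (univ.biUnion fun t => C t - A t).card = 62 := by
    rw [card_biUnion_sub (OmegaCensus.stpp_rotate (OmegaCensus.stpp_rotate h)) hBne]
    simp [hC, hA, Fin.sum_univ_four]
  have hL : 124 ≤ ((univ.biUnion fun t => A t - B t) - (univ.biUnion fun t => A t - B t)).card := by
    refine le_card_sub_of_dmin _ (card_pos.1 (by omega)) 124 fun q u k hk hqu => ?_
    rw [hH] at hk; rw [hDc] at hqu
    have hq : q ≤ 124 := by
      rcases Nat.eq_zero_or_pos k with h0 | h0
      · rw [h0] at hk; omega
      · nlinarith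
    interval_cases q <;> omega
  have := energy_lower_bound h 5 (fun i => by rw [hC i]; fin_cases i <;> simp) 124 hL
  rw [hEc, hFc, hH] at this
  omega

/-- Rotation instance `(5,3,4),(3,5,4),(4,4,4),(4,4,4)`. [original] -/
theorem no_isSTPP_534_354_444x2_order124 (hH : Fintype.card H = 124) (A B C : Fin 4 → Finset H)
    (hA : ∀ i, (A i).card = ![5, 3, 4, 4] i) (hB : ∀ i, (B i).card = ![3, 5, 4, 4] i) (hC : ∀ i, (C i).card = 4) :
    ¬ IsSTPP A B C := fun h =>
  -- rotate to (B, C, A): shapes (3,4,5),(5,4,3),… ; then swap members 0 and 1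
  no_isSTPP_543_345_444x2_order124 hH _ _ _ (fun i => by fin_cases i <;> simp [hB]) (fun i => hC _)
    (fun i => by fin_cases i <;> simp [hA]) (isSTPP_swap01 (OmegaCensus.stpp_rotate h))

/-- Rotation instance `(4,5,3),(4,3,5),(4,4,4),(4,4,4)`. [original] -/
theorem no_isSTPP_453_435_444x2_order124 (hH : Fintype.card H = 124) (A B C : Fin 4 → Finset H)
    (hA : ∀ i, (A i).card = 4) (hB : ∀ i, (B i).card = ![5, 3, 4, 4] i) (hC : ∀ i, (C i).card = ![3, 5, 4, 4] i) :
    ¬ IsSTPP A B C := fun h =>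
  -- rotate to (C, A, B): shapes (3,4,5),(5,4,3),… ; then swap members 0 and 1
  no_isSTPP_543_345_444x2_order124 hH _ _ _ (fun i => by fin_cases i <;> simp [hC]) (fun i => hA _)
    (fun i => by fin_cases i <;> simp [hB]) (isSTPP_swap01 (OmegaCensus.stpp_rotate (OmegaCensus.stpp_rotate h)))

/-- **Q3.10 at 120: no `IsSTPP` family with shapes `(4,4,4),(4,4,4),(4,4,4),(4,4,3)` in an abelian group of order
`120`** (`|D − D| = 120`, per-difference bound `52`, `120·52 > 60²`); the three abelian groups of order `120` at once.
[original] -/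
theorem no_isSTPP_444x3_443_order120 (hH : Fintype.card H = 120) (A B C : Fin 4 → Finset H)
    (hA : ∀ i, (A i).card = 4) (hB : ∀ i, (B i).card = 4) (hC : ∀ i, (C i).card = ![4, 4, 4, 3] i) :
    ¬ IsSTPP A B C := by
  intro h
  have hAne : ∀ i, (A i).Nonempty := fun i => card_pos.1 (by rw [hA i]; norm_num)
  have hBne : ∀ i, (B i).Nonempty := fun i => card_pos.1 (by rw [hB i]; norm_num)
  have hCne : ∀ i, (C i).Nonempty := fun i => card_pos.1 (by rw [hC i]; fin_cases i <;> simp)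
  have hDc : (univ.biUnion fun t => A t - B t).card = 64 := by
    rw [card_biUnion_sub h hCne]; simp [hA, hB]
  have hEc : (univ.biUnion fun t => B t - C t).card = 60 := by
    rw [card_biUnion_sub (OmegaCensus.stpp_rotate h) hAne]; simp [hB, hC, Fin.sum_univ_four]
  have hFc : (univ.biUnion fun t => C t - A t).card = 60 := by
    rw [card_biUnion_sub (OmegaCensus.stpp_rotate (OmegaCensus.stpp_rotate h)) hBne]
    simp [hC, hA, Fin.sum_univ_four]
  have hL : 120 ≤ ((univ.biUnion fun t => A t - B t) - (univ.biUnion fun t => A t - B t)).card := by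
    refine le_card_sub_of_dmin _ (card_pos.1 (by omega)) 120 fun q u k hk hqu => ?_
    rw [hH] at hk; rw [hDc] at hqu
    have hq : q ≤ 120 := by
      rcases Nat.eq_zero_or_pos k with h0 | h0
      · rw [h0] at hk; omega
      · nlinarith
    interval_cases q <;> omega
  have := energy_lower_bound h 4 (fun i => by rw [hC i]; fin_cases i <;> simp) 120 hL
  rw [hEc, hFc, hH] at this
  omega

/-- Rotation instance `(4,4,4)³,(3,4,4)` at order `120`. [original] -/
theorem no_isSTPP_444x3_344_order120 (hH : Fintype.card H = 120) (A B C : Fin 4 → Finset H)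
    (hA : ∀ i, (A i).card = ![4, 4, 4, 3] i) (hB : ∀ i, (B i).card = 4) (hC : ∀ i, (C i).card = 4) :
    ¬ IsSTPP A B C := fun h =>
  no_isSTPP_444x3_443_order120 hH B C A hB hC hA (OmegaCensus.stpp_rotate h)

/-- Rotation instance `(4,4,4)³,(4,3,4)` at order `120`. [original] -/
theorem no_isSTPP_444x3_434_order120 (hH : Fintype.card H = 120) (A B C : Fin 4 → Finset H)
    (hA : ∀ i, (A i).card = 4) (hB : ∀ i, (B i).card = ![4, 4, 4, 3] i) (hC : ∀ i, (C i).card = 4) :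
    ¬ IsSTPP A B C := fun h =>
  no_isSTPP_444x3_443_order120 hH C A B hC hA hB (OmegaCensus.stpp_rotate (OmegaCensus.stpp_rotate h))

/-- **Q3.9: no `IsSTPP` family with shapes `(4,4,4),(4,4,4),(4,4,4),(3,3,3)` in an abelian group of order `111`**
(`|D − D| = 111`, per-difference bound `52`, `111·52 > 57²`). [original] -/
theorem no_isSTPP_444x3_333_order111 (hH : Fintype.card H = 111) (A B C : Fin 4 → Finset H)
    (hA : ∀ i, (A i).card = ![4, 4, 4, 3] i) (hB : ∀ i, (B i).card = ![4, 4, 4, 3] i)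
    (hC : ∀ i, (C i).card = ![4, 4, 4, 3] i) : ¬ IsSTPP A B C := by
  intro h
  have hAne : ∀ i, (A i).Nonempty := fun i => card_pos.1 (by rw [hA i]; fin_cases i <;> simp)
  have hBne : ∀ i, (B i).Nonempty := fun i => card_pos.1 (by rw [hB i]; fin_cases i <;> simp)
  have hCne : ∀ i, (C i).Nonempty := fun i => card_pos.1 (by rw [hC i]; fin_cases i <;> simp)
  have hDc : (univ.biUnion fun t => A t - B t).card = 57 := by
    rw [card_biUnion_sub h hCne]; simp [hA, hB, Fin.sum_univ_four]
  have hEc : (univ.biUnion fun t => B t - C t).card = 57 := by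
    rw [card_biUnion_sub (OmegaCensus.stpp_rotate h) hAne]; simp [hB, hC, Fin.sum_univ_four]
  have hFc : (univ.biUnion fun t => C t - A t).card = 57 := by
    rw [card_biUnion_sub (OmegaCensus.stpp_rotate (OmegaCensus.stpp_rotate h)) hBne]
    simp [hC, hA, Fin.sum_univ_four]
  have hL : 111 ≤ ((univ.biUnion fun t => A t - B t) - (univ.biUnion fun t => A t - B t)).card := by
    refine le_card_sub_of_dmin _ (card_pos.1 (by omega)) 111 fun q u k hk hqu => ?_
    rw [hH] at hk; rw [hDc] at hqu
    have hq : q ≤ 111 := by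
      rcases Nat.eq_zero_or_pos k with h0 | h0
      · rw [h0] at hk; omega
      · nlinarith
    interval_cases q <;> omega
  have := energy_lower_bound h 4 (fun i => by rw [hC i]; fin_cases i <;> simp) 111 hL
  rw [hEc, hFc, hH] at this
  omega

/-- **Order 125, the slack-1 multiset (Q3.8): no `IsSTPP` family with shapes `(5,5,3),(5,3,5),(3,5,5),(3,3,3)` in an
abelian group of order `125`** (`|D − D| = 125`, per-difference bound `57`, `125·57 > 64²`; the planner's refereed hand
proof Q38-SLACK-PROOF.md is a different route). [original] -/
theorem no_isSTPP_553_535_355_333_order125 (hH : Fintype.card H = 125) (A B C : Fin 4 → Finset H)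
    (hA : ∀ i, (A i).card = ![5, 5, 3, 3] i) (hB : ∀ i, (B i).card = ![5, 3, 5, 3] i)
    (hC : ∀ i, (C i).card = ![3, 5, 5, 3] i) : ¬ IsSTPP A B C := by
  intro h
  have hAne : ∀ i, (A i).Nonempty := fun i => card_pos.1 (by rw [hA i]; fin_cases i <;> simp)
  have hBne : ∀ i, (B i).Nonempty := fun i => card_pos.1 (by rw [hB i]; fin_cases i <;> simp)
  have hCne : ∀ i, (C i).Nonempty := fun i => card_pos.1 (by rw [hC i]; fin_cases i <;> simp)
  have hDc : (univ.biUnion fun t => A t - B t).card = 64 := by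
    rw [card_biUnion_sub h hCne]; simp [hA, hB, Fin.sum_univ_four]
  have hEc : (univ.biUnion fun t => B t - C t).card = 64 := by
    rw [card_biUnion_sub (OmegaCensus.stpp_rotate h) hAne]; simp [hB, hC, Fin.sum_univ_four]
  have hFc : (univ.biUnion fun t => C t - A t).card = 64 := by
    rw [card_biUnion_sub (OmegaCensus.stpp_rotate (OmegaCensus.stpp_rotate h)) hBne]
    simp [hC, hA, Fin.sum_univ_four]
  have hL : 125 ≤ ((univ.biUnion fun t => A t - B t) - (univ.biUnion fun t => A t - B t)).card := by
    refine le_card_sub_of_dmin _ (card_pos.1 (by omega)) 125 fun q u k hk hqu => ?_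
    rw [hH] at hk; rw [hDc] at hqu
    have hq : q ≤ 125 := by
      rcases Nat.eq_zero_or_pos k with h0 | h0
      · rw [h0] at hk; omega
      · nlinarith
    interval_cases q <;> omega
  have := energy_lower_bound h 5 (fun i => by rw [hC i]; fin_cases i <;> simp) 125 hL
  rw [hEc, hFc, hH] at this
  omega

/-- **Order 125, four `(4,4,4)` members** (eng-1's THEOREM B, kernel p403556 + main file; this is an independent
second-moment proof: `|D − D| = 125`, per-difference bound `59`, `125·59 > 64²`). [original] -/
theorem no_isSTPP_444x4_order125 (hH : Fintype.card H = 125) (A B C : Fin 4 → Finset H)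
    (hA : ∀ i, (A i).card = 4) (hB : ∀ i, (B i).card = 4) (hC : ∀ i, (C i).card = 4) :
    ¬ IsSTPP A B C := by
  intro h
  have hAne : ∀ i, (A i).Nonempty := fun i => card_pos.1 (by rw [hA i]; norm_num)
  have hBne : ∀ i, (B i).Nonempty := fun i => card_pos.1 (by rw [hB i]; norm_num)
  have hCne : ∀ i, (C i).Nonempty := fun i => card_pos.1 (by rw [hC i]; norm_num)
  have hDc : (univ.biUnion fun t => A t - B t).card = 64 := by
    rw [card_biUnion_sub h hCne]; simp [hA, hB]
  have hEc : (univ.biUnion fun t => B t - C t).card = 64 := by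
    rw [card_biUnion_sub (OmegaCensus.stpp_rotate h) hAne]; simp [hB, hC]
  have hFc : (univ.biUnion fun t => C t - A t).card = 64 := by
    rw [card_biUnion_sub (OmegaCensus.stpp_rotate (OmegaCensus.stpp_rotate h)) hBne]; simp [hC, hA]
  have hL : 125 ≤ ((univ.biUnion fun t => A t - B t) - (univ.biUnion fun t => A t - B t)).card := by
    refine le_card_sub_of_dmin _ (card_pos.1 (by omega)) 125 fun q u k hk hqu => ?_
    rw [hH] at hk; rw [hDc] at hqu
    have hq : q ≤ 125 := by
      rcases Nat.eq_zero_or_pos k with h0 | h0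
      · rw [h0] at hk; omega
      · nlinarith
    interval_cases q <;> omega
  have := energy_lower_bound h 4 (fun i => (hC i).le) 125 hL
  rw [hEc, hFc, hH] at this
  omega

end STPPEnergy

end Summit.MatrixMultiplication.MatrixMultiplication.Theorems
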